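import Summits.QuantumFields.BalabanUV.InfraRed.StrongCouplingPoincareDoorSUN
import Literature.MathematicalPhysics.QuantumLattice.LatticeGaugeDLRProofs
import Literature.LinearAlgebra.Matrix.SingularValueDecomposition
import HarnessLib

/-!
# Venture YMGap — BI-INVARIANCE of the one-link law's functionals on `SU(N)`: under `B ↦ U B V` (`U, V ∈ SU(N)`) the variance of every
# observable, the linear-observable variance bound and the Lipschitz Poincaré constant of `ν_B(dg) ∝ exp(N Re tr(gB)) dg` are unchanged

HONEST FRAMING.  Venture file of the cell `pub-ymgap` (QuantumFields programme), seat engine-2 (g12); 0 compute.  Exact change-of-variables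
identities for ONE tilted Haar law on `SU(N)` (the one-link conditional law of lattice Yang–Mills); no number of record.  NOT weak coupling, NOT a
continuum statement, NOT a Yang–Mills mass-gap claim.  PURPOSE: the reduction step of any future CERTIFICATE for the cell's numerical hypotheses
H1 (`OneLinkPoincareSUN 3 (3/5) (4/5)`) / H2 (`OneLinkVarianceBound 3 (11/30) (49/20)`): both functionals of `B` are constant on the orbits
`{U B V}`, so a certificate needs only the representatives `B = e^{iφ}·diag(s₁,…,s_N)` (singular values and one phase) — the «bi-unitary
invariance» the cell's two engines checked to `1e−14` (SU3-RADIUS.md), here a theorem.  Nothing is certified in this file.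

WHAT (all `[folklore]`; `τ_{V,U}(g) = V g U`, Haar is bi-invariant (`QuantumLattice.measurePreserving_mul_mul_inv_haarProbability`)):
* `integral_comp_biTranslate`: `∫ F(V g U) dσ(g) = ∫ F dσ`;
* `integral_exp_tilt_biTranslate`: `∫ e^{S(VgU)} ψ(g) dσ = ∫ e^{S(h)} ψ(V⁻¹ h U⁻¹) dσ(h)`; `integral_tilted_biTranslate`: the same for the tilted probability;
* `variance_tilted_biTranslate`: `Var[ψ; σ^{S∘τ}] = Var[ψ ∘ τ⁻¹; σ^S]` (continuous `ψ`);
* `pot_biTranslate`: `N Re tr((VgU)B) = N Re tr(g·(UBV))` — so `σ^{S_B ∘ τ_{V,U}} = ν_{UBV}`; `linear_comp_biTranslate_inv`: `N Re tr((V⁻¹hU⁻¹)Δ) = N Re tr(h·(U⁻¹ΔV⁻¹))`;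
* ★ `variance_linear_conj`: `Var_{ν_{UBV}}(N Re tr(gΔ)) = Var_{ν_B}(N Re tr(g·U⁻¹ΔV⁻¹))`;
* ★ `varianceBoundAt_conj`: `(∀ Δ, Var_{ν_B}(N Re tr gΔ) ≤ v‖Δ‖_F²) → ∀ Δ, Var_{ν_{UBV}}(N Re tr gΔ) ≤ v‖Δ‖_F²` (`‖U⁻¹ΔV⁻¹‖_F = ‖Δ‖_F`);
* ★ `poincareAt_conj`: the same transfer for the Lipschitz variance bound `Var_{ν}(ψ) ≤ c M²` over all `M`-Lipschitz `ψ` (Frobenius distance is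
  bi-invariant).
* §4 (APPEND, g12): ★ `exists_specialUnitary_rep` — every `B ∈ M_N(ℂ)` is `U · diagonal(u·σ) · V` with `U, V ∈ SU(N)`, `‖u‖ = 1`, `0 ≤ σᵢ ≤ ‖B‖_op`
  (Horn–Johnson 2.6.3 via the tree's `Literature.LinearAlgebra.Matrix.exists_svd`, the unitary factors pushed into `SU(N)` by an `N`-th root of their
  determinants); ★ `oneLinkVarianceBound_of_reps`, ★ `oneLinkPoincareSUN_of_reps` — the schemas `OneLinkVarianceBound N R v` /
  `OneLinkPoincareSUN N R c` FOLLOW from their restriction to the representatives `diagonal(u·σ)`, `‖u‖ = 1`, `0 ≤ σᵢ ≤ R` (an `N + 1`-parameter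
  compact family: for `SU(3)`, three singular values and one phase) — the exact reduction a certificate for H1/H2 would start from.
NOT CLAIMED: any bound on either functional; nothing is certified here.

References: H. Shen, R. Zhu, X. Zhu, CMP 400 (2023) §4.1 (the one-link law); the tree's `StrongCouplingPoincareDoorSUN` / `StrongCouplingVarianceDoorSUN`
(schemas H1/H2), `QuantumLattice.LatticeGaugeDLRProofs` (bi-invariance of Haar); cell notes `HOME/pub-ymgap-engine-2/SU3-RADIUS.md`, `LANE-MEMO-g12.md` §3.
-/

noncomputable section

open scoped Matrix ComplexConjugate BigOperators
open Matrix Complex MeasureTheory ProbabilityTheory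
open Literature.MathematicalPhysics.QuantumFieldTheory
open Literature.MathematicalPhysics.QuantumFieldTheory.SUNBakryEmery
open Literature.MathematicalPhysics.QuantumLattice (measurePreserving_mul_mul_inv_haarProbability)

namespace Summit.Ventures.YMGap.OneLinkBiInvariance

variable {N : ℕ}

/-! ### 1. Haar is bi-invariant: change of variables `g ↦ V g U` -/

/-- The bi-translation `g ↦ V g U` as a measurable equivalence of `SU(N)`. [folklore] -/
theorem measurableEmbedding_biTranslate (V U : SUN N) : MeasurableEmbedding fun g : SUN N => V * g * U :=
  (((Homeomorph.mulLeft V).trans (Homeomorph.mulRight U)).toMeasurableEquiv).measurableEmbedding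

/-- **Change of variables** `∫ F(V g U) dσ(g) = ∫ F dσ` for the Haar probability `σ` of `SU(N)` and every `F`. [folklore] -/
theorem integral_comp_biTranslate (V U : SUN N) (F : SUN N → ℝ) :
    ∫ g, F (V * g * U) ∂(haarSU N) = ∫ g, F g ∂(haarSU N) := by
  have h := measurePreserving_mul_mul_inv_haarProbability (G := SUN N) V U⁻¹
  simp only [inv_inv] at h
  exact h.integral_comp (measurableEmbedding_biTranslate V U) F

/-- `V⁻¹ (V g U) U⁻¹ = g`. [folklore] -/
theorem biTranslate_inv_apply (V U g : SUN N) : V⁻¹ * (V * g * U) * U⁻¹ = g := by group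

/-- `V (V⁻¹ h U⁻¹) U = h`. [folklore] -/
theorem biTranslate_apply_inv (V U h : SUN N) : V * (V⁻¹ * h * U⁻¹) * U = h := by group

/-- **Tilting commutes with the change of variables** (weighted form): `∫ e^{S(VgU)} ψ(g) dσ(g) = ∫ e^{S(h)} ψ(V⁻¹ h U⁻¹) dσ(h)`. [folklore] -/
theorem integral_exp_tilt_biTranslate (V U : SUN N) (S ψ : SUN N → ℝ) :
    ∫ g, Real.exp (S (V * g * U)) * ψ g ∂(haarSU N) = ∫ h, Real.exp (S h) * ψ (V⁻¹ * h * U⁻¹) ∂(haarSU N) := by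
  have h := integral_comp_biTranslate V U (fun h => Real.exp (S h) * ψ (V⁻¹ * h * U⁻¹))
  simp only [biTranslate_inv_apply] at h
  exact h

/-- **Tilted expectations**: `∫ ψ dσ^{S∘τ} = ∫ ψ∘τ⁻¹ dσ^S`, `τ(g) = V g U`. [folklore] -/
theorem integral_tilted_biTranslate (V U : SUN N) (S ψ : SUN N → ℝ) :
    ∫ g, ψ g ∂((haarSU N).tilted fun g => S (V * g * U)) = ∫ h, ψ (V⁻¹ * h * U⁻¹) ∂((haarSU N).tilted S) := by
  rw [integral_tilted_eq_div, integral_tilted_eq_div, integral_exp_tilt_biTranslate]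
  have hZ : ∫ g, Real.exp (S (V * g * U)) ∂(haarSU N) = ∫ h, Real.exp (S h) ∂(haarSU N) :=
    integral_comp_biTranslate V U (fun h => Real.exp (S h))
  rw [hZ]

/-- **Variance**: `Var[ψ; σ^{S∘τ}] = Var[ψ∘τ⁻¹; σ^S]` for continuous `ψ`, `τ(g) = V g U`. [folklore] -/
theorem variance_tilted_biTranslate (V U : SUN N) (S : SUN N → ℝ) {ψ : SUN N → ℝ} (hψ : Continuous ψ) :
    Var[ψ; (haarSU N).tilted fun g => S (V * g * U)] = Var[fun h => ψ (V⁻¹ * h * U⁻¹); (haarSU N).tilted S] := by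
  have hτ : Continuous fun h : SUN N => V⁻¹ * h * U⁻¹ := (continuous_const.mul continuous_id).mul continuous_const
  have hψ' : Continuous fun h : SUN N => ψ (V⁻¹ * h * U⁻¹) := hψ.comp hτ
  have hm : ∫ g, ψ g ∂((haarSU N).tilted fun g => S (V * g * U)) = ∫ h, ψ (V⁻¹ * h * U⁻¹) ∂((haarSU N).tilted S) :=
    integral_tilted_biTranslate V U S ψ
  rw [ProbabilityTheory.variance_eq_integral hψ.aemeasurable, ProbabilityTheory.variance_eq_integral hψ'.aemeasurable]
  have h2 := integral_tilted_biTranslate V U S (fun g => (ψ g - ∫ h, ψ (V⁻¹ * h * U⁻¹) ∂((haarSU N).tilted S)) ^ 2)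
  rw [hm]
  exact h2

/-! ### 2. The one-link potential and the linear observables under `B ↦ U B V` -/

/-- `N Re tr((V g U) B) = N Re tr(g · (U B V))` (cyclicity of the trace). [folklore] -/
theorem pot_biTranslate (V U g : SUN N) (B : Matrix (Fin N) (Fin N) ℂ) :
    (N : ℝ) * (((V * g * U : SUN N) : Matrix (Fin N) (Fin N) ℂ) * B).trace.re =
      (N : ℝ) * ((g : Matrix (Fin N) (Fin N) ℂ) * ((U : Matrix (Fin N) (Fin N) ℂ) * B * (V : Matrix (Fin N) (Fin N) ℂ))).trace.re := by
  congr 2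
  rw [Submonoid.coe_mul, Submonoid.coe_mul, Matrix.mul_assoc, Matrix.mul_assoc, trace_mul_comm]
  simp only [Matrix.mul_assoc]

/-- `N Re tr((V⁻¹ h U⁻¹) Δ) = N Re tr(h · (U⁻¹ Δ V⁻¹))`. [folklore] -/
theorem linear_comp_biTranslate_inv (V U h : SUN N) (Δ : Matrix (Fin N) (Fin N) ℂ) :
    (N : ℝ) * (((V⁻¹ * h * U⁻¹ : SUN N) : Matrix (Fin N) (Fin N) ℂ) * Δ).trace.re =
      (N : ℝ) * ((h : Matrix (Fin N) (Fin N) ℂ) * (((U⁻¹ : SUN N) : Matrix (Fin N) (Fin N) ℂ) * Δ * ((V⁻¹ : SUN N) : Matrix (Fin N) (Fin N) ℂ))).trace.re :=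
  pot_biTranslate V⁻¹ U⁻¹ h Δ

/-- `‖U⁻¹ Δ V⁻¹‖_F = ‖Δ‖_F` for `U, V ∈ SU(N)`. [folklore] -/
theorem frobNorm_conj_inv (V U : SUN N) (Δ : Matrix (Fin N) (Fin N) ℂ) :
    frobNorm (((U⁻¹ : SUN N) : Matrix (Fin N) (Fin N) ℂ) * Δ * ((V⁻¹ : SUN N) : Matrix (Fin N) (Fin N) ℂ)) = frobNorm Δ := by
  rw [frobNorm_mul_unitary _ (SUN.mem_unitaryGroup V⁻¹), frobNorm_unitary_mul (SUN.mem_unitaryGroup U⁻¹)]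

/-! ### 3. ★ Bi-invariance of the variance of linear observables, of the variance bound, of the Poincaré constant -/

/-- ★ **`Var_{ν_{UBV}}(N Re tr(gΔ)) = Var_{ν_B}(N Re tr(g·U⁻¹ΔV⁻¹))`** for `U, V ∈ SU(N)`, every `B, Δ ∈ M_N(ℂ)` (`ν_B = σ^{N Re tr(·B)}`). [folklore] -/
theorem variance_linear_conj (U V : SUN N) (B Δ : Matrix (Fin N) (Fin N) ℂ) :
    Var[fun g : SUN N => (N : ℝ) * ((g : Matrix (Fin N) (Fin N) ℂ) * Δ).trace.re ;
        (haarSU N).tilted fun g => (N : ℝ) * ((g : Matrix (Fin N) (Fin N) ℂ) * ((U : Matrix (Fin N) (Fin N) ℂ) * B * (V : Matrix (Fin N) (Fin N) ℂ))).trace.re] =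
      Var[fun h : SUN N => (N : ℝ) * ((h : Matrix (Fin N) (Fin N) ℂ) *
          (((U⁻¹ : SUN N) : Matrix (Fin N) (Fin N) ℂ) * Δ * ((V⁻¹ : SUN N) : Matrix (Fin N) (Fin N) ℂ))).trace.re ;
        (haarSU N).tilted fun g => (N : ℝ) * ((g : Matrix (Fin N) (Fin N) ℂ) * B).trace.re] := by
  have hψ : Continuous fun g : SUN N => (N : ℝ) * ((g : Matrix (Fin N) (Fin N) ℂ) * Δ).trace.re :=
    continuous_restrict (contDiff_pot (N : ℝ) Δ)
  have hS : (fun g : SUN N => (N : ℝ) * ((g : Matrix (Fin N) (Fin N) ℂ) * ((U : Matrix (Fin N) (Fin N) ℂ) * B * (V : Matrix (Fin N) (Fin N) ℂ))).trace.re) =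
      fun g : SUN N => (N : ℝ) * (((V * g * U : SUN N) : Matrix (Fin N) (Fin N) ℂ) * B).trace.re :=
    funext fun g => (pot_biTranslate V U g B).symm
  have key := variance_tilted_biTranslate V U (fun h : SUN N => (N : ℝ) * ((h : Matrix (Fin N) (Fin N) ℂ) * B).trace.re) hψ
  rw [hS, key]
  simp only [linear_comp_biTranslate_inv]

/-- ★ **The linear-observable variance bound is bi-invariant**: if `Var_{ν_B}(N Re tr gΔ) ≤ v‖Δ‖_F²` for every `Δ`, then the same holds for
`ν_{UBV}`, `U, V ∈ SU(N)`.  (So a certificate for H2 needs only one `B` per orbit `{UBV}`.) [folklore] -/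
theorem varianceBoundAt_conj {v : ℝ} {B : Matrix (Fin N) (Fin N) ℂ}
    (h : ∀ Δ : Matrix (Fin N) (Fin N) ℂ,
      Var[fun g : SUN N => (N : ℝ) * ((g : Matrix (Fin N) (Fin N) ℂ) * Δ).trace.re ;
        (haarSU N).tilted fun g => (N : ℝ) * ((g : Matrix (Fin N) (Fin N) ℂ) * B).trace.re] ≤ v * frobNorm Δ ^ 2)
    (U V : SUN N) (Δ : Matrix (Fin N) (Fin N) ℂ) :
    Var[fun g : SUN N => (N : ℝ) * ((g : Matrix (Fin N) (Fin N) ℂ) * Δ).trace.re ;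
        (haarSU N).tilted fun g => (N : ℝ) * ((g : Matrix (Fin N) (Fin N) ℂ) * ((U : Matrix (Fin N) (Fin N) ℂ) * B * (V : Matrix (Fin N) (Fin N) ℂ))).trace.re]
      ≤ v * frobNorm Δ ^ 2 := by
  rw [variance_linear_conj U V B Δ, ← frobNorm_conj_inv V U Δ]
  exact h _

/-- The Frobenius distance on `SU(N)` is bi-invariant: `d(V⁻¹aU⁻¹, V⁻¹bU⁻¹) = d(a, b)`. [folklore] -/
theorem suFrobDist_biTranslate_inv (V U a b : SUN N) : suFrobDist (V⁻¹ * a * U⁻¹) (V⁻¹ * b * U⁻¹) = suFrobDist a b := by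
  unfold suFrobDist
  rw [Submonoid.coe_mul, Submonoid.coe_mul, Submonoid.coe_mul, Submonoid.coe_mul, ← Matrix.sub_mul, ← Matrix.mul_sub,
    frobNorm_mul_unitary _ (SUN.mem_unitaryGroup U⁻¹), frobNorm_unitary_mul (SUN.mem_unitaryGroup V⁻¹)]

/-- ★ **The Lipschitz Poincaré constant is bi-invariant**: if every `M`-Lipschitz `ψ` has `Var_{ν_B}(ψ) ≤ c M²`, then the same holds for `ν_{UBV}`,
`U, V ∈ SU(N)` (a certificate for H1 needs one `B` per orbit). [folklore] -/
theorem poincareAt_conj {c : ℝ} {B : Matrix (Fin N) (Fin N) ℂ}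
    (h : ∀ (ψ : SUN N → ℝ) (M : ℝ), 0 ≤ M → (∀ a b : SUN N, |ψ a - ψ b| ≤ M * suFrobDist a b) →
      Var[ψ ; (haarSU N).tilted fun g => (N : ℝ) * ((g : Matrix (Fin N) (Fin N) ℂ) * B).trace.re] ≤ c * M ^ 2)
    (U V : SUN N) (ψ : SUN N → ℝ) (M : ℝ) (hM : 0 ≤ M) (hψ : ∀ a b : SUN N, |ψ a - ψ b| ≤ M * suFrobDist a b) :
    Var[ψ ; (haarSU N).tilted fun g => (N : ℝ) * ((g : Matrix (Fin N) (Fin N) ℂ) * ((U : Matrix (Fin N) (Fin N) ℂ) * B * (V : Matrix (Fin N) (Fin N) ℂ))).trace.re]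
      ≤ c * M ^ 2 := by
  have hψc : Continuous ψ := continuous_of_lipschitz_suFrobDist hψ
  have hS : (fun g : SUN N => (N : ℝ) * ((g : Matrix (Fin N) (Fin N) ℂ) * ((U : Matrix (Fin N) (Fin N) ℂ) * B * (V : Matrix (Fin N) (Fin N) ℂ))).trace.re) =
      fun g : SUN N => (N : ℝ) * (((V * g * U : SUN N) : Matrix (Fin N) (Fin N) ℂ) * B).trace.re :=
    funext fun g => (pot_biTranslate V U g B).symm
  have key := variance_tilted_biTranslate V U (fun h : SUN N => (N : ℝ) * ((h : Matrix (Fin N) (Fin N) ℂ) * B).trace.re) hψc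
  rw [hS, key]
  refine h _ M hM fun a b => ?_
  have := hψ (V⁻¹ * a * U⁻¹) (V⁻¹ * b * U⁻¹)
  rwa [suFrobDist_biTranslate_inv] at this

/-! ### 4. (APPEND) Reduction of the schemas to the representatives `diagonal(u·σ)`, `‖u‖ = 1`, `0 ≤ σᵢ ≤ ‖B‖_op` -/

section Reps

open Summit.QuantumFields.BalabanUV.InfraRed.StrongCouplingVarianceDoorSUN (OneLinkVarianceBound)
open Summit.QuantumFields.BalabanUV.InfraRed.StrongCouplingPoincareDoorSUN (OneLinkPoincareSUN)

/-- A unitary matrix is a unit complex multiple of a special unitary one: `X = z • X₁`, `‖z‖ = 1`, `X₁ ∈ SU(N)` (`z` an `N`-th root of `det X`).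
[folklore] -/
theorem exists_smul_specialUnitary_of_mem_unitaryGroup (hN : 1 ≤ N) {X : Matrix (Fin N) (Fin N) ℂ} (hX : X ∈ Matrix.unitaryGroup (Fin N) ℂ) :
    ∃ z : ℂ, ∃ X₁ : SUN N, ‖z‖ = 1 ∧ X = z • (X₁ : Matrix (Fin N) (Fin N) ℂ) := by
  have hdet : ‖X.det‖ = 1 := CStarRing.norm_of_mem_unitary (Matrix.det_of_mem_unitary hX)
  obtain ⟨z, hz⟩ := IsAlgClosed.exists_pow_nat_eq X.det (by omega : 0 < N)
  have hz1 : ‖z‖ = 1 := by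
    have h : ‖z‖ ^ N = 1 := by rw [← norm_pow, hz, hdet]
    exact (pow_eq_one_iff_of_nonneg (norm_nonneg z) (by omega)).1 h
  have hz0 : z ≠ 0 := fun h => by rw [h, norm_zero] at hz1; exact zero_ne_one hz1
  have hzz : (starRingEnd ℂ) z * z = 1 := by
    rw [← Complex.normSq_eq_conj_mul_self, Complex.normSq_eq_norm_sq, hz1]
    norm_num
  -- `z⁻¹ • X ∈ SU(N)`
  have hX' : star X * X = 1 := Matrix.mem_unitaryGroup_iff'.1 hX
  have hzz' : star z * z = 1 := by rw [Complex.star_def]; exact hzz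
  have hmem : z⁻¹ • X ∈ Matrix.specialUnitaryGroup (Fin N) ℂ := by
    refine Matrix.mem_specialUnitaryGroup_iff.2 ⟨Matrix.mem_unitaryGroup_iff'.2 ?_, ?_⟩
    · rw [star_smul, smul_mul_smul_comm, hX', star_inv₀, ← mul_inv, hzz', inv_one, one_smul]
    · rw [Matrix.det_smul, Fintype.card_fin, ← hz, inv_pow, inv_mul_cancel₀ (pow_ne_zero _ hz0)]
  refine ⟨z, ⟨z⁻¹ • X, hmem⟩, hz1, ?_⟩
  show X = z • (z⁻¹ • X)
  rw [smul_smul, mul_inv_cancel₀ hz0, one_smul]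

/-- **Singular values are at most the operator norm**: if `B = V · diagonal(σ) · W⋆` with `V, W` unitary and `σ ≥ 0`, then `σᵢ ≤ ‖B‖_op`
(`σᵢ = ‖B (W eᵢ-column)‖_F ≤ ‖B‖_op`). [folklore] -/
theorem svd_sigma_le_matrixOpNorm {B V W : Matrix (Fin N) (Fin N) ℂ} {σ : Fin N → ℝ} (hV : V ∈ Matrix.unitaryGroup (Fin N) ℂ)
    (hW : W ∈ Matrix.unitaryGroup (Fin N) ℂ) (hσ : ∀ i, 0 ≤ σ i) (hB : B = V * diagonal (fun i => ((σ i : ℝ) : ℂ)) * star W) (i : Fin N) :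
    σ i ≤ matrixOpNorm B := by
  set E : Matrix (Fin N) (Fin N) ℂ := diagonal (Pi.single i (1 : ℂ)) with hE
  have hWW : star W * W = 1 := Matrix.mem_unitaryGroup_iff'.1 hW
  -- `B (W E) = V · diagonal(single i σᵢ)`
  have hprod : B * (W * E) = V * diagonal (Pi.single i ((σ i : ℝ) : ℂ)) := by
    rw [hB, Matrix.mul_assoc, ← Matrix.mul_assoc (star W), hWW, Matrix.one_mul, Matrix.mul_assoc, hE, diagonal_mul_diagonal]
    congr 2
    funext j
    by_cases hj : j = i
    · subst hj; simp
    · simp [Pi.single_eq_of_ne hj]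
  -- Frobenius norms of the diagonal matrices with one entry
  have hdiag : ∀ c : ℂ, frobNorm (diagonal (Pi.single i c) : Matrix (Fin N) (Fin N) ℂ) = ‖c‖ := by
    intro c
    have hsq : frobNorm (diagonal (Pi.single i c) : Matrix (Fin N) (Fin N) ℂ) ^ 2 = ‖c‖ ^ 2 := by
      rw [frobNorm_sq]
      rw [Finset.sum_eq_single i (fun j _ hj => ?_) (fun h => (h (Finset.mem_univ i)).elim)]
      · rw [Finset.sum_eq_single i (fun k _ hk => by rw [diagonal_apply_ne _ (Ne.symm hk), norm_zero, zero_pow two_ne_zero])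
          (fun h => (h (Finset.mem_univ i)).elim), diagonal_apply_eq, Pi.single_eq_same]
      · refine Finset.sum_eq_zero fun k _ => ?_
        by_cases hjk : j = k
        · subst hjk; rw [diagonal_apply_eq, Pi.single_eq_of_ne hj, norm_zero, zero_pow two_ne_zero]
        · rw [diagonal_apply_ne _ hjk, norm_zero, zero_pow two_ne_zero]
    exact (sq_eq_sq₀ (frobNorm_nonneg _) (norm_nonneg c)).1 hsq
  have h1 : frobNorm (B * (W * E)) ≤ matrixOpNorm B * frobNorm (W * E) := frobNorm_mul_le_matrixOpNorm_mul B (W * E)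
  rw [hprod, frobNorm_unitary_mul hV, frobNorm_unitary_mul hW, hE, hdiag, hdiag, norm_one, mul_one, Complex.norm_real,
    Real.norm_eq_abs, abs_of_nonneg (hσ i)] at h1
  exact h1

/-- ★ **Every `B ∈ M_N(ℂ)` is `U · diagonal(u·σ) · V` with `U, V ∈ SU(N)`, `‖u‖ = 1`, `0 ≤ σᵢ ≤ ‖B‖_op`** (singular value decomposition, Horn–Johnson
Thm. 2.6.3, with the unitary factors normalised into `SU(N)`). [cite: HornJohnson2013, Thm. 2.6.3 (p0202)] -/
theorem exists_specialUnitary_rep (hN : 1 ≤ N) (B : Matrix (Fin N) (Fin N) ℂ) :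
    ∃ U V : SUN N, ∃ u : ℂ, ∃ σ : Fin N → ℝ, ‖u‖ = 1 ∧ (∀ i, 0 ≤ σ i) ∧ (∀ i, σ i ≤ matrixOpNorm B) ∧
      B = (U : Matrix (Fin N) (Fin N) ℂ) * diagonal (fun i => u * ((σ i : ℝ) : ℂ)) * (V : Matrix (Fin N) (Fin N) ℂ) := by
  obtain ⟨V, hV, W, hW, σ, hσ, hB, -, -⟩ := Literature.LinearAlgebra.Matrix.exists_svd (𝕜 := ℂ) B
  -- the SVD is stated with `RCLike.ofReal`; restate it with the `ℝ → ℂ` coercion of this file (definitionally equal)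
  have hB' : B = V * diagonal (fun i => ((σ i : ℝ) : ℂ)) * star W := hB
  obtain ⟨zV, V₁, hzV, hVeq⟩ := exists_smul_specialUnitary_of_mem_unitaryGroup hN hV
  obtain ⟨zW, W₁, hzW, hWeq⟩ := exists_smul_specialUnitary_of_mem_unitaryGroup hN hW
  have hσle : ∀ i, σ i ≤ matrixOpNorm B := svd_sigma_le_matrixOpNorm hV hW hσ hB'
  refine ⟨V₁, W₁⁻¹, zV * star zW, σ, ?_, hσ, hσle, ?_⟩
  · rw [norm_mul, norm_star, hzV, hzW, mul_one]
  · have hstarW : star W = star zW • ((W₁⁻¹ : SUN N) : Matrix (Fin N) (Fin N) ℂ) := by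
      rw [hWeq, star_smul]
      rfl
    have hcD : (zV * star zW) • diagonal (fun i => ((σ i : ℝ) : ℂ)) = diagonal (fun i => zV * star zW * ((σ i : ℝ) : ℂ)) := by
      rw [← diagonal_smul]
      rfl
    have hVD : (zV * star zW) • ((V₁ : Matrix (Fin N) (Fin N) ℂ) * diagonal (fun i => ((σ i : ℝ) : ℂ))) =
        (V₁ : Matrix (Fin N) (Fin N) ℂ) * diagonal (fun i => zV * star zW * ((σ i : ℝ) : ℂ)) := by
      rw [← hcD, Matrix.mul_smul]
    rw [hB', hVeq, hstarW, Matrix.smul_mul, Matrix.smul_mul, Matrix.mul_smul, smul_smul, ← Matrix.smul_mul, hVD]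

/-- ★ **`OneLinkVarianceBound N R v` from the representatives**: if for every `‖u‖ = 1` and `0 ≤ σᵢ ≤ R` the law `ν_{diagonal(u·σ)}` satisfies
`Var(N Re tr gΔ) ≤ v‖Δ‖_F²` for all `Δ`, then the bound holds on the whole operator-norm ball (`exists_specialUnitary_rep` + `varianceBoundAt_conj`).
[folklore] -/
theorem oneLinkVarianceBound_of_reps (hN : 1 ≤ N) {R v : ℝ}
    (h : ∀ (u : ℂ) (σ : Fin N → ℝ), ‖u‖ = 1 → (∀ i, 0 ≤ σ i) → (∀ i, σ i ≤ R) → ∀ Δ : Matrix (Fin N) (Fin N) ℂ,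
      Var[fun g : SUN N => (N : ℝ) * ((g : Matrix (Fin N) (Fin N) ℂ) * Δ).trace.re ;
        (haarSU N).tilted fun g => (N : ℝ) * ((g : Matrix (Fin N) (Fin N) ℂ) * diagonal (fun i => u * ((σ i : ℝ) : ℂ))).trace.re]
          ≤ v * frobNorm Δ ^ 2) :
    OneLinkVarianceBound N R v := by
  intro B hB Δ
  obtain ⟨U, V, u, σ, hu, hσ0, hσB, hBeq⟩ := exists_specialUnitary_rep hN B
  rw [hBeq]
  exact varianceBoundAt_conj (h u σ hu hσ0 fun i => (hσB i).trans hB) U V Δ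

/-- ★ **`OneLinkPoincareSUN N R c` from the representatives**: if for every `‖u‖ = 1`, `0 ≤ σᵢ ≤ R` every `M`-Lipschitz `ψ` has
`Var_{ν_{diagonal(u·σ)}}(ψ) ≤ c M²`, then `OneLinkPoincareSUN N R c` (`exists_specialUnitary_rep` + `poincareAt_conj`). [folklore] -/
theorem oneLinkPoincareSUN_of_reps (hN : 1 ≤ N) {R c : ℝ}
    (h : ∀ (u : ℂ) (σ : Fin N → ℝ), ‖u‖ = 1 → (∀ i, 0 ≤ σ i) → (∀ i, σ i ≤ R) →
      ∀ (ψ : SUN N → ℝ) (M : ℝ), 0 ≤ M → (∀ a b : SUN N, |ψ a - ψ b| ≤ M * suFrobDist a b) →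
        Var[ψ ; (haarSU N).tilted fun g => (N : ℝ) * ((g : Matrix (Fin N) (Fin N) ℂ) * diagonal (fun i => u * ((σ i : ℝ) : ℂ))).trace.re]
          ≤ c * M ^ 2) :
    OneLinkPoincareSUN N R c := by
  intro B hB ψ M hM hψ
  obtain ⟨U, V, u, σ, hu, hσ0, hσB, hBeq⟩ := exists_specialUnitary_rep hN B
  rw [hBeq]
  exact poincareAt_conj (h u σ hu hσ0 fun i => (hσB i).trans hB) U V ψ M hM hψ

end Reps

end Summit.Ventures.YMGap.OneLinkBiInvariance

end
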